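import Literature.AlgebraicGeometry.Resolution.ChowLemmaProofs
import HarnessLib

/-!
# The closure of the graph of a morphism on an open: de Jong 1996, 4.17 ("the closure of the image")

Topic: `Literature/AlgebraicGeometry/Resolution`. In de Jong 1996, 4.17 the base `Y` is altered
to a projective variety `Y'` carrying a morphism to the moduli scheme:

> "Put `Y'` equal to the closure of `Im(U' → Y ×_k ℓM̄_{g,n})`. It is clear that `Y'` is a
> projective variety over `k` and that `ψ : Y' → Y` is an alteration which is generically
> étale. […] (The 1-morphism `U' → U → M_{g,n}` extends to `Y' → ℓM̄_{g,n} → […]` by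
> construction.)" (p. 72)

With `U'` realised as an open of a scheme `N` (finite over `Y`, companion file
`FiniteCoverCompactification.lean`), this is the **closure of the graph** of `U' → ℓM̄_{g,n}`
inside `N ×_k ℓM̄_{g,n}`. This file PROVES the general statement behind "by construction"
(`exists_graphClosure_compactification`): for an open immersion `j : U' → N` with `U'`
integral, a separated `π : P → N` and a quasi-compact `γ : U' → P` over `N` (`γ ≫ π = j`; in
4.17 `P = N ×_k ℓM̄_{g,n}`, `γ = (j, U' → ℓM̄_{g,n})`), the scheme-theoretic image `Y'` of `γ`
(Mathlib's `Scheme.Hom.image`) is an integral closed subscheme of `P`, the corestriction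
`s : U' → Y'` is a dense open immersion, and `Y' → N` is an isomorphism over `U'` — precisely,
the square `s, 𝟙, Y' → N, j` is cartesian. The mechanism is that of 4.18–4.19 for the closure
`T` of the graph of `β` (`AlterationsGraphClosure.lean`): `U' → Y'` is a dominant section of the
separated `Y' → N` over the open `U'`, hence an isomorphism onto the preimage of `U'`
(`ChowLemmaProof.isIso_morphismRestrict_of_section`).

## References

* A. J. de Jong, *Smoothness, semi-stability and alterations*, Publ. Math. IHÉS 83 (1996), 4.17,
  p. 72; 4.18–4.19, pp. 72–73. [DeJong1996]
* The Stacks Project, Tag 01R8 (scheme-theoretic image). [StacksProject]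
-/

noncomputable section

open CategoryTheory CategoryTheory.Limits AlgebraicGeometry TopologicalSpace Topology

namespace Literature.AlgebraicGeometry.Resolution

universe u

namespace GraphClosureCompactification

variable {U' N P : Scheme.{u}} (j : U' ⟶ N) [IsOpenImmersion j] (π : P ⟶ N) [IsSeparated π]
  (γ : U' ⟶ P) [QuasiCompact γ] (hγ : γ ≫ π = j)

omit [IsOpenImmersion j] [IsSeparated π] [QuasiCompact γ] in
include hγ in
/-- The corestriction `U' → im(γ)` followed by `im(γ) → P → N` is `j`. [folklore] -/
theorem toImage_comp : γ.toImage ≫ γ.imageι ≫ π = j := by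
  rw [Scheme.Hom.toImage_imageι_assoc, hγ]

include hγ in
/-- **`im(γ) → N` is an isomorphism over `U'` and its preimage of `U'` is dense**, for `U'`
reduced: `U' → im(γ)` is a dominant section of the separated `im(γ) → N` over the open
`U' ⊆ N`. [cite: DeJong1996, 4.18–4.19, pp. 72–73] -/
theorem isIso_morphismRestrict_opensRange [IsReduced U'] :
    IsIso ((γ.imageι ≫ π) ∣_ j.opensRange) ∧
      Dense (((γ.imageι ≫ π) ⁻¹ᵁ j.opensRange : γ.image.Opens) : Set γ.image) := by
  haveI : IsReduced γ.image := ChowLemmaProof.isReduced_image γ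
  haveI : IsSeparated (γ.imageι ≫ π) := inferInstance
  haveI : IsDominant (j.isoOpensRange.inv ≫ γ.toImage) := inferInstance
  refine ChowLemmaProof.isIso_morphismRestrict_of_section (γ.imageι ≫ π) j.opensRange
    (j.isoOpensRange.inv ≫ γ.toImage) ?_
  rw [Category.assoc, toImage_comp j π γ hγ, Scheme.Hom.isoOpensRange_inv_comp]

include hγ in
/-- **The corestriction `s : U' → im(γ)` is an open immersion onto the preimage of `U'`**, for
`U'` reduced. [folklore] -/
theorem isOpenImmersion_toImage_and_range [IsReduced U'] :
    IsOpenImmersion γ.toImage ∧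
      Set.range γ.toImage = (((γ.imageι ≫ π) ⁻¹ᵁ j.opensRange : γ.image.Opens) : Set γ.image) := by
  set pr : γ.image ⟶ N := γ.imageι ≫ π with hpr
  set U : N.Opens := j.opensRange
  obtain ⟨hiso, -⟩ := isIso_morphismRestrict_opensRange j π γ hγ
  -- `s` factors through the open `pr⁻¹(U)`
  have hrange : Set.range γ.toImage ⊆ Set.range (pr ⁻¹ᵁ U).ι := by
    rw [Scheme.Opens.range_ι]
    rintro _ ⟨x, rfl⟩
    show pr (γ.toImage x) ∈ U
    rw [← Scheme.Hom.comp_apply, hpr, toImage_comp j π γ hγ]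
    exact ⟨x, rfl⟩
  set s' := IsOpenImmersion.lift (pr ⁻¹ᵁ U).ι γ.toImage hrange with hs'
  have hs'ι : s' ≫ (pr ⁻¹ᵁ U).ι = γ.toImage := IsOpenImmersion.lift_fac _ _ _
  -- and there it is `U' ≅ U` followed by the inverse of the isomorphism `pr⁻¹(U) → U`
  have hs'pr : s' ≫ (pr ∣_ U) = j.isoOpensRange.hom := by
    rw [← cancel_mono U.ι, Category.assoc, morphismRestrict_ι, ← Category.assoc, hs'ι, hpr,
      toImage_comp j π γ hγ]
    exact (Scheme.Hom.isoOpensRange_hom_ι j).symm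
  haveI : IsIso s' := by
    have h : s' = j.isoOpensRange.hom ≫ inv (pr ∣_ U) := by
      rw [← hs'pr, Category.assoc, IsIso.hom_inv_id, Category.comp_id]
    rw [h]
    infer_instance
  have hs : γ.toImage = s' ≫ (pr ⁻¹ᵁ U).ι := hs'ι.symm
  refine ⟨by rw [hs]; infer_instance, ?_⟩
  rw [← Scheme.Opens.range_ι (pr ⁻¹ᵁ U), hs]
  apply le_antisymm
  · rintro _ ⟨x, rfl⟩
    exact ⟨s' x, (Scheme.Hom.comp_apply _ _ x).symm⟩
  · rintro _ ⟨v, rfl⟩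
    obtain ⟨x, rfl⟩ := (asIso s').hom.surjective v
    exact ⟨x, Scheme.Hom.comp_apply _ _ x⟩

include hγ in
/-- **The square `U' → im(γ)`, `𝟙`, `im(γ) → N`, `j` is cartesian** (`im(γ) → N` is an
isomorphism over `U'`), for `U'` reduced. [folklore] -/
theorem isPullback_toImage [IsReduced U'] :
    IsPullback γ.toImage (𝟙 U') (γ.imageι ≫ π) j := by
  obtain ⟨hs, hrange⟩ := isOpenImmersion_toImage_and_range j π γ hγ
  haveI := hs
  refine (IsOpenImmersion.isPullback (𝟙 U') γ.toImage j (γ.imageι ≫ π)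
    (by rw [Category.id_comp, toImage_comp j π γ hγ]) ?_).flip
  ext1
  rw [Scheme.Hom.coe_opensRange, hrange]

include hγ in
/-- The image of `U' → im(γ)` is dense, for `U'` reduced. [folklore] -/
theorem dense_range_toImage [IsReduced U'] : Dense (Set.range γ.toImage) := by
  obtain ⟨-, hdense⟩ := isIso_morphismRestrict_opensRange j π γ hγ
  obtain ⟨-, hrange⟩ := isOpenImmersion_toImage_and_range j π γ hγ
  rwa [hrange]

end GraphClosureCompactification

open GraphClosureCompactification in
/-- **The closure of the graph** (de Jong 1996, 4.17: "Put `Y'` equal to the closure of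
`Im(U' → Y ×_k ℓM̄_{g,n})` […] The 1-morphism `U' → U → M_{g,n}` extends to `Y' → ℓM̄_{g,n}` […]
by construction"). Let `j : U' → N` be an open immersion with `U'` integral, `π : P → N`
separated and `γ : U' → P` quasi-compact with `γ ≫ π = j` (in 4.17: `P = N ×_k ℓM̄_{g,n}` for a
compactification `N ⊇ U'` over `Y`, `γ = (j, U' → ℓM̄_{g,n})`). Then there are an INTEGRAL scheme
`Y'` — the scheme-theoretic image of `γ` —, a closed immersion `c : Y' → P` and a morphism
`s : U' → Y'` with `s ≫ c = γ`, such that `s` is an open immersion with dense image and the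
square `s, 𝟙_{U'}, c ≫ π, j` is cartesian (`Y' → N` is an isomorphism over `U'`). In
particular `c ≫ π` is proper when `π` is, `Y'` is projective when `P` is, and every morphism
`P → M` restricts along `s` to its composite with `γ`. [cite: DeJong1996, 4.17, p. 72] -/
theorem exists_graphClosure_compactification {U' N P : Scheme.{u}} [IsIntegral U'] (j : U' ⟶ N)
    [IsOpenImmersion j] (π : P ⟶ N) [IsSeparated π] (γ : U' ⟶ P) [QuasiCompact γ]
    (hγ : γ ≫ π = j) :
    ∃ (Y' : Scheme.{u}) (c : Y' ⟶ P) (s : U' ⟶ Y'), IsIntegral Y' ∧ IsClosedImmersion c ∧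
      s ≫ c = γ ∧ IsOpenImmersion s ∧ Dense (Set.range s) ∧ IsPullback s (𝟙 U') (c ≫ π) j :=
  ⟨γ.image, γ.imageι, γ.toImage, ChowLemmaProof.isIntegral_image γ, inferInstance,
    γ.toImage_imageι, (isOpenImmersion_toImage_and_range j π γ hγ).1,
    dense_range_toImage j π γ hγ, isPullback_toImage j π γ hγ⟩

end Literature.AlgebraicGeometry.Resolution

end
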